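import Mathlib
import HarnessLib

/-!
# Viscous CLM on the torus (`a = 0`, `σ = 2`): the reflective cell-chain certificate — CLOSING KIT (exact rational checks of the
# finitely many closing inequalities, evaluated by the kernel)

HONEST FRAMING (cell ns-blowup GROUP B «PROFILE SEARCH», zone Z3, row Z3-U addendum A-F2 of `HOME/profile/z3/CENSUS-Z3.md`;
human rulings D-0035/D-0074; Z3-TWIN lineage, eng-5 g13): **1-D MODEL; exact rational arithmetic, kernel-checked; not Euler, not
Navier–Stokes; «violates: none — MODEL».**

After `CellChain.runB_sound` (envelope tables `U`, `L` of the scaled cascade `F_k = c^k E_k`, naturals meaning `n/2^P`), the closing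
theorems `family_lower_bound_at` (blow-up, with `λ = 1`) and `super_tail_induction` (global existence, with `β = 1`) need finitely many
inequalities between DYADIC RATIONALS: `−δ ≤ d_j ≤ Δ`, `0 ≤ A j + d_j`, `D₀ ≤ Σ d_j`, `Σ j d_j ≤ D₁` (`d_j = ℓ_j/2^P − A j`), resp.
`U_j ≤ B j + X_j`, `Σ X_j ≤ E`. This file states them as ONE computable check over `ℚ` each (`upCheck`, `lowCheck`, structural
recursion `sumTo`/`allTo`) and proves the real-valued consequences (`upCheck_sound`, `lowCheck_sound`), so an instance file discharges all
of them by a single `decide`. bears_on: LADDER-NS N5 / zone Z3 (row Z3-U) → N1 linear core. WHAT THIS IS NOT: not NS; no number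
certified by THIS file.
-/

namespace Summit.NavierStokesRegularity.OSWSelfSimilar
namespace SheetNSLineTorusCascade
namespace CellChain

open Finset Real Set

/-- `sumTo f n = f 0 + … + f (n−1)` (structural). [folklore] -/
def sumTo (f : ℕ → ℚ) : ℕ → ℚ
  | 0 => 0
  | n + 1 => sumTo f n + f n

/-- `allTo p n = p 0 && … && p (n−1)` (structural). [folklore] -/
def allTo (p : ℕ → Bool) : ℕ → Bool
  | 0 => true
  | n + 1 => allTo p n && p n

/-- `sumTo` is the `Finset.range` sum. [folklore] -/
theorem sumTo_eq (f : ℕ → ℚ) : ∀ n, sumTo f n = ∑ j ∈ range n, f j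
  | 0 => by simp [sumTo]
  | n + 1 => by rw [sumTo, sum_range_succ, sumTo_eq f n]

/-- `allTo` means every index below `n` passes. [folklore] -/
theorem allTo_spec {p : ℕ → Bool} : ∀ {n}, allTo p n = true → ∀ j, j < n → p j = true
  | 0, _, j, hj => absurd hj (Nat.not_lt_zero j)
  | n + 1, h, j, hj => by
    rw [allTo, Bool.and_eq_true] at h
    rcases Nat.lt_succ_iff_lt_or_eq.mp hj with hj' | rfl
    · exact allTo_spec h.1 j hj'
    · exact h.2

/-! ### Blow-up side: the perturbation `d` of the family `A j` -/

/-- The perturbation `d_j = ℓ_j/2^P − A j` for `1 ≤ j ≤ K₁` (`0` otherwise) from the lower table `ℓ` (index = mode; entry `0` unused),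
over `ℚ`. [new here — MODEL] -/
def dQ (P K₁ : ℕ) (ell : List ℕ) (A : ℚ) (j : ℕ) : ℚ :=
  if j = 0 then 0 else if K₁ < j then 0 else (ell.getD j 0 : ℚ) / 2 ^ P - A * j

/-- **The blow-up closing check** (all over `ℚ`): `−δ ≤ d_j ≤ Δ`, `0 ≤ A j + d_j` for `j ≤ K₁`; `D₀ ≤ Σ_{j≤K₁} d_j`;
`Σ_{j≤K₁} j d_j ≤ D₁`. [new here — MODEL] -/
def upCheck (P K₁ : ℕ) (ell : List ℕ) (A δ Δ D₀ D₁ : ℚ) : Bool :=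
  allTo (fun j => decide (-δ ≤ dQ P K₁ ell A j) && decide (dQ P K₁ ell A j ≤ Δ) && decide (0 ≤ A * j + dQ P K₁ ell A j)) (K₁ + 1)
    && decide (D₀ ≤ sumTo (dQ P K₁ ell A) (K₁ + 1))
    && decide (sumTo (fun j => (j : ℚ) * dQ P K₁ ell A j) (K₁ + 1) ≤ D₁)

/-- **Soundness of the blow-up closing check**, in the real-valued shape of `family_lower_bound_at` with `d j = (dQ … j : ℝ)`.
[new here — MODEL] -/
theorem upCheck_sound {P K₁ : ℕ} {ell : List ℕ} {A δ Δ D₀ D₁ : ℚ} (h : upCheck P K₁ ell A δ Δ D₀ D₁ = true) :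
    (dQ P K₁ ell A 0 : ℝ) = 0 ∧ (∀ j, K₁ < j → (dQ P K₁ ell A j : ℝ) = 0) ∧
    (∀ j, -((δ : ℚ) : ℝ) ≤ (dQ P K₁ ell A j : ℝ)) ∧ (∀ j, (dQ P K₁ ell A j : ℝ) ≤ ((Δ : ℚ) : ℝ)) ∧
    (∀ j, j ≤ K₁ → 0 ≤ ((A : ℚ) : ℝ) * (j : ℝ) + (dQ P K₁ ell A j : ℝ)) ∧
    ((D₀ : ℚ) : ℝ) ≤ ∑ j ∈ range (K₁ + 1), ((dQ P K₁ ell A j : ℚ) : ℝ) ∧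
    ∑ j ∈ range (K₁ + 1), (j : ℝ) * ((dQ P K₁ ell A j : ℚ) : ℝ) ≤ ((D₁ : ℚ) : ℝ) := by
  simp only [upCheck, Bool.and_eq_true, decide_eq_true_eq] at h
  obtain ⟨⟨hall, hD₀⟩, hD₁⟩ := h
  have hj : ∀ j, j ≤ K₁ → -δ ≤ dQ P K₁ ell A j ∧ dQ P K₁ ell A j ≤ Δ ∧ 0 ≤ A * j + dQ P K₁ ell A j := by
    intro j hjK
    have := allTo_spec hall j (Nat.lt_succ_of_le hjK)
    simp only [Bool.and_eq_true, decide_eq_true_eq] at this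
    exact ⟨this.1.1, this.1.2, this.2⟩
  have hδ0 : 0 ≤ δ := by have := (hj 0 (Nat.zero_le _)).1; simp [dQ] at this; linarith
  have hΔ0 : 0 ≤ Δ := by have := (hj 0 (Nat.zero_le _)).2.1; simp [dQ] at this; linarith
  have hzero : ∀ j, K₁ < j → dQ P K₁ ell A j = 0 := fun j hj => by simp [dQ, hj, show j ≠ 0 by omega]
  refine ⟨by simp [dQ], fun j hj => by rw [hzero j hj]; simp, fun j => ?_, fun j => ?_, fun j hjK => ?_, ?_, ?_⟩
  · rcases Nat.lt_or_ge K₁ j with hj' | hj'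
    · rw [hzero j hj']; simp; exact_mod_cast hδ0
    · exact_mod_cast (hj j hj').1
  · rcases Nat.lt_or_ge K₁ j with hj' | hj'
    · rw [hzero j hj']; simp; exact_mod_cast hΔ0
    · exact_mod_cast (hj j hj').2.1
  · exact_mod_cast (hj j hjK).2.2
  · rw [sumTo_eq] at hD₀; exact_mod_cast hD₀
  · rw [sumTo_eq] at hD₁; exact_mod_cast hD₁

/-- The family value `A j + d_j` IS the table entry: `A j + dQ j = ℓ_j/2^P` for `1 ≤ j ≤ K₁`. [new here — MODEL] -/
theorem A_add_dQ {P K₁ : ℕ} {ell : List ℕ} {A : ℚ} {j : ℕ} (hj1 : 1 ≤ j) (hjK : j ≤ K₁) :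
    ((A : ℚ) : ℝ) * (j : ℝ) + ((dQ P K₁ ell A j : ℚ) : ℝ) = ((ell.getD j 0 : ℕ) : ℝ) / 2 ^ P := by
  have h0 : j ≠ 0 := by omega
  have hK : ¬K₁ < j := by omega
  simp only [dQ, h0, hK, if_false]
  push_cast
  ring

/-! ### Global side: the excesses `X` -/

/-- The head suprema `U_j = u_j/2^P` (`j ≥ 1`; `U_0 = 0`) from the upper table `u` (index = mode; entry `0` unused), over `ℚ`.
[new here — MODEL] -/
def UQ (P : ℕ) (u : List ℕ) (j : ℕ) : ℚ := if j = 0 then 0 else (u.getD j 0 : ℚ) / 2 ^ P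

/-- The excesses `X_j = x_j/2^P` from the table `x` (index = mode), over `ℚ`. [new here — MODEL] -/
def XQ (P : ℕ) (x : List ℕ) (j : ℕ) : ℚ := (x.getD j 0 : ℚ) / 2 ^ P

/-- **The global-existence closing check** (all over `ℚ`): `U_j ≤ B j + X_j` for `j ≤ K₀` and `Σ_{j≤K₀} X_j ≤ E`. [new here — MODEL] -/
def lowCheck (P K₀ : ℕ) (u x : List ℕ) (B E : ℚ) : Bool :=
  allTo (fun j => decide (UQ P u j ≤ B * j + XQ P x j)) (K₀ + 1) && decide (sumTo (XQ P x) (K₀ + 1) ≤ E)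

/-- **Soundness of the global-existence closing check**, in the real-valued shape of `super_tail_induction` with `β = 1`,
`U j = (UQ … j : ℝ)`, `X j = (XQ … j : ℝ)`. [new here — MODEL] -/
theorem lowCheck_sound {P K₀ : ℕ} {u x : List ℕ} {B E : ℚ} (h : lowCheck P K₀ u x B E = true) :
    (∀ j, 0 ≤ (UQ P u j : ℝ)) ∧ (∀ j, 0 ≤ (XQ P x j : ℝ)) ∧
    (∀ j, j ≤ K₀ → ((UQ P u j : ℚ) : ℝ) * (1 : ℝ) ^ j ≤ ((B : ℚ) : ℝ) * (j : ℝ) + ((XQ P x j : ℚ) : ℝ)) ∧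
    ∑ j ∈ range (K₀ + 1), ((XQ P x j : ℚ) : ℝ) ≤ ((E : ℚ) : ℝ) := by
  simp only [lowCheck, Bool.and_eq_true, decide_eq_true_eq] at h
  obtain ⟨hall, hE⟩ := h
  refine ⟨fun j => ?_, fun j => ?_, fun j hj => ?_, ?_⟩
  · unfold UQ; split_ifs <;> positivity
  · unfold XQ; positivity
  · have := allTo_spec hall j (Nat.lt_succ_of_le hj)
    simp only [decide_eq_true_eq] at this
    rw [one_pow, mul_one]
    exact_mod_cast this
  · rw [sumTo_eq] at hE; exact_mod_cast hE

/-- Reading the tables: entry `1` of `0 :: x₁ :: rest` is `x₁`, entry `i + 2` is `rest[i]`. [folklore] -/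
theorem getD_table (x₁ : ℕ) (rest : List ℕ) (i : ℕ) :
    (0 :: x₁ :: rest).getD 1 0 = x₁ ∧ (0 :: x₁ :: rest).getD (i + 2) 0 = rest.getD i 0 := by simp

/-- `UQ` at mode `1` and at the modes `i + 2`, for a table `0 :: x₁ :: rest`. [new here — MODEL] -/
theorem UQ_table (P x₁ : ℕ) (rest : List ℕ) (i : ℕ) :
    ((UQ P (0 :: x₁ :: rest) 1 : ℚ) : ℝ) = (x₁ : ℝ) / 2 ^ P ∧
    ((UQ P (0 :: x₁ :: rest) (i + 2) : ℚ) : ℝ) = ((rest.getD i 0 : ℕ) : ℝ) / 2 ^ P ∧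
    ((UQ P (0 :: x₁ :: rest) 0 : ℚ) : ℝ) = 0 := by
  refine ⟨?_, ?_, by simp [UQ]⟩ <;> simp [UQ]

end CellChain
end SheetNSLineTorusCascade
end Summit.NavierStokesRegularity.OSWSelfSimilar
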